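import Mathlib
import Summits.Parity.GeneralizedHardyLittlewood.Theorems.LiouvilleShiftedTablesEHHighConductorReduction
import Summits.Parity.GeneralizedHardyLittlewood.Theorems.LiouvilleShiftedTablesEHLevelOfPurityAt
import Summits.Parity.GeneralizedHardyLittlewood.Theorems.LiouvilleShiftedTablesEHPurityLogOfEH

/-!
# Purity of the excised discrepancy below `x^{1/2}` (crux `EH`, stmt-Parity-11314)

Line `upward-replication-free-factorability`: its UNCONDITIONAL half.  Write, at height `x`,
conductor cut `D` and modulus `m`,
`E♯_D(x; m) = max_{a unit} ‖φ(m)⁻¹ ∑_{χ mod m, cond χ > D} χ(a⁻¹) ψ(x, χ)‖` (maximal conductor-excised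
discrepancy).  The line's one open stub asks for *purity* of `E♯` — few moduli in a dyadic window
`(x^{1−ε'}, 2x^{1−ε'}]` with `E♯_D(x; m) ≥ x/(φ(m)(log x)^B)` — for the windows ABOVE `x^{1/2}`
(`ε' ≤ 1/2`), where it is equivalent to a new level of distribution of the primes
(`OfTopWindowPurity.eh_level_of_purityAt`, `Localisation.eh_below_iff_purityLog_below`) and open.
This file proves the complementary statement: in every window BELOW `x^{1/2}` (`1/2 < ε' < 1`)
POWER-sparse purity holds unconditionally, with cut `D = ⌊x^{1/4}⌋` and exceptional set of size
`≤ x^{1−ε'−η}`, `η = min((1−ε')/2, (ε'−1/2)/2, 1/24)`: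

* `purityAt_of_gt_half` — exactly the hypothesis `hPurity` of `eh_level_of_purityAt` at `ε'`;
* `eh_of_lt_half` — hence `EH θ` (Wave0 form) for every `θ < 1/2` THROUGH the line (the
  Bombieri–Vinogradov range; of course also `Literature.NumberTheory.Sieve.eh_of_bombieri_vinogradov`).

Proof: Markov's inequality on the first moment `∑_{q ≤ 2x^{1−ε'}} E♯_D(x; q)`, bounded by the
high-conductor reduction with Vaughan's mean value theorem
(`HighConductorReduction.exists_sum_excised_le`): the conductor ranges contribute
`x/D ≤ x^{3/4}`, `x^{5/6}` and `x^{1/2} · 2x^{1−ε'}` (times `(log x)^7`), each `≤ x^{1−2η}` precisely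
because `ε' > 1/2` — the large-sieve term `x^{1/2} Q` is what stops at `Q = x^{1/2}`
(`Literature.Barriers.Parity.LargeSieveLevelHalf`).  So the tree now holds the kernel-checked
dichotomy for this line: its purity stub is a THEOREM in every window below `x^{1/2}` and
EQUIVALENT TO A LEVEL OF DISTRIBUTION `> 1/2` in every window above it.

References: R. C. Vaughan, Acta Arith. 37 (1980), Theorem 1; H. Davenport, *Multiplicative Number
Theory*, ch. 28; line card `Cruxes/EH/Lines/upward-replication-free-factorability.md`.
-/


namespace Summit.Parity.GeneralizedHardyLittlewood.Theorems.EH.PurityBelowHalf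

open Finset Real Filter Asymptotics
open Literature.NumberTheory.Sieve

/-- One term of the final comparison: if `c · P ≤ x^η` and `a + 2η ≤ 1` then
`c · P · x^a ≤ x^{1−η}` (`x ≥ 1`). [folklore] -/
theorem term_le {x c P a η : ℝ} (hx : 1 ≤ x) (hE : c * P ≤ x ^ η) (ha : a + 2 * η ≤ 1) :
    c * P * x ^ a ≤ x ^ (1 - η) := by
  have hx0 : 0 < x := by linarith
  calc c * P * x ^ a ≤ x ^ η * x ^ a :=
        mul_le_mul_of_nonneg_right hE (Real.rpow_nonneg hx0.le _)
    _ = x ^ (η + a) := (Real.rpow_add hx0 η a).symm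
    _ ≤ x ^ (1 - η) := Real.rpow_le_rpow_of_exponent_le hx (by linarith)

/-- The eventual side conditions in `x` for `purityAt_of_gt_half`: `x ≥ 2`, `log x ≥ K₀`, and
`(log x)^{B+8} ≤ x^η`. [folklore] -/
theorem eventually_conds (K₀ B : ℝ) {η : ℝ} (hη : 0 < η) :
    ∀ᶠ x : ℝ in atTop, 2 ≤ x ∧ K₀ ≤ Real.log x ∧ Real.log x ^ (B + 8) ≤ x ^ η :=
  (eventually_ge_atTop 2).and ((Real.tendsto_log_atTop.eventually_ge_atTop K₀).and
    (eventually_log_rpow_le_rpow (B + 8) hη))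

/-- **The first moment in a window below `x`, explicit form.** For `x ≥ 2` with `log x ≥ 1`,
`ε' < 1`, `Q = ⌊2x^{1−ε'}⌋`, `D = ⌊x^{1/4}⌋`: the right-hand side of
`HighConductorReduction.sum_excised_le_vaughan` is at most
`2916 C₁ (log x)^7 (x^{ε'} + x^{3/4} + x^{5/6} + x^{3/2−ε'}) + 72 (log x)^4 x^{1−ε'}`
(`W(Q) ≤ 9 log²x`, `log(xQ) ≤ 3 log x`, `x/(Q+1) ≤ x^{ε'}`, `x/(D+1) ≤ x^{3/4}`,
`x^{1/2} Q ≤ 2x^{3/2−ε'}`). [folklore] -/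
theorem firstMoment_le {x ε' C₁ S : ℝ} (hx2 : 2 ≤ x) (hL1 : 1 ≤ Real.log x) (hε'0 : 0 ≤ ε')
    (hε'1 : ε' < 1) (hC₁ : 0 ≤ C₁)
    (hS : S ≤ totientInvSum ⌊2 * x ^ (1 - ε')⌋₊ *
        (C₁ * Real.log (x * ⌊2 * x ^ (1 - ε')⌋₊) ^ 4 *
          (x / (⌊2 * x ^ (1 - ε')⌋₊ + 1) + x ^ (5 / 6 : ℝ) + x ^ (1 / 2 : ℝ) * ⌊2 * x ^ (1 - ε')⌋₊ +
            (x / (⌊x ^ (1 / 2 - 1 / 4 : ℝ)⌋₊ + 1) +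
              x ^ (5 / 6 : ℝ) * (1 + Real.log ⌊2 * x ^ (1 - ε')⌋₊) +
              x ^ (1 / 2 : ℝ) * ⌊2 * x ^ (1 - ε')⌋₊))) +
        ⌊Real.log x / Real.log 2⌋₊ *
          ((⌊2 * x ^ (1 - ε')⌋₊ : ℝ) * Real.log ⌊2 * x ^ (1 - ε')⌋₊ *
            totientInvSum ⌊2 * x ^ (1 - ε')⌋₊)) :
    S ≤ 2916 * C₁ * Real.log x ^ 7 *
        (x ^ ε' + x ^ (3 / 4 : ℝ) + x ^ (5 / 6 : ℝ) + x ^ (3 / 2 - ε')) +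
      72 * Real.log x ^ 4 * x ^ (1 - ε') := by
  -- notation
  set L := Real.log x with hLdef
  set X := x ^ (1 - ε') with hXdef
  set Q := ⌊2 * X⌋₊ with hQdef
  set D := ⌊x ^ (1 / 2 - 1 / 4 : ℝ)⌋₊ with hDdef
  have hx0 : 0 < x := by linarith
  have hx1 : 1 ≤ x := by linarith
  have hL0 : 0 < L := by linarith
  have hX1 : 1 ≤ X := Real.one_le_rpow hx1 (by linarith)
  have hX0 : 0 < X := by linarith
  have hQ1 : 1 ≤ Q := Nat.le_floor (by rw [Nat.cast_one]; linarith)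
  have hQle : (Q : ℝ) ≤ 2 * X := Nat.floor_le (by positivity)
  have hQlt : 2 * X < (Q : ℝ) + 1 := Nat.lt_floor_add_one _
  have hDlt : x ^ (1 / 2 - 1 / 4 : ℝ) < (D : ℝ) + 1 := Nat.lt_floor_add_one _
  -- (1) logarithms and weights
  have hlog2 : (1 : ℝ) / 2 < Real.log 2 := by have := Real.log_two_gt_d9; linarith
  have hlog2L : Real.log 2 ≤ L := Real.log_le_log (by norm_num) hx2
  have hX_le_x : X ≤ x := by
    calc X ≤ x ^ (1 : ℝ) := Real.rpow_le_rpow_of_exponent_le hx1 (by linarith)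
      _ = x := Real.rpow_one x
  have hQx : (Q : ℝ) ≤ 2 * x := hQle.trans (by linarith)
  have hQpos : (0 : ℝ) < Q := by exact_mod_cast hQ1
  have hlogQ : Real.log Q ≤ 2 * L := by
    calc Real.log Q ≤ Real.log (2 * x) := Real.log_le_log hQpos hQx
      _ = Real.log 2 + L := by rw [Real.log_mul (by norm_num) hx0.ne']
      _ ≤ 2 * L := by linarith
  have hlogQ0 : 0 ≤ Real.log Q := Real.log_nonneg (by exact_mod_cast hQ1)
  have h1logQ : 1 + Real.log Q ≤ 3 * L := by linarith
  have hWQ : totientInvSum Q ≤ 9 * L ^ 2 := by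
    calc totientInvSum Q ≤ (1 + Real.log Q) ^ 2 := totientInvSum_le Q
      _ ≤ (3 * L) ^ 2 := pow_le_pow_left₀ (by linarith) h1logQ 2
      _ = 9 * L ^ 2 := by ring
  have hlogxQ : Real.log (x * Q) ≤ 3 * L := by
    rw [Real.log_mul hx0.ne' hQpos.ne']; linarith
  have hlogxQ0 : 0 ≤ Real.log (x * Q) := Real.log_nonneg (by nlinarith)
  have hlog4 : Real.log (x * Q) ^ 4 ≤ 81 * L ^ 4 := by
    calc Real.log (x * Q) ^ 4 ≤ (3 * L) ^ 4 := pow_le_pow_left₀ hlogxQ0 hlogxQ 4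
      _ = 81 * L ^ 4 := by ring
  have hfl : (⌊L / Real.log 2⌋₊ : ℝ) ≤ 2 * L := by
    refine (Nat.floor_le (by positivity)).trans ?_
    rw [div_le_iff₀ (by linarith)]; nlinarith
  -- (2) the bracket
  have hbr1 : x / (Q + 1) ≤ x ^ ε' := by
    rw [div_le_iff₀ (by positivity)]
    have e : x = x ^ ε' * X := by
      rw [hXdef, ← Real.rpow_add hx0]
      have : ε' + (1 - ε') = 1 := by ring
      rw [this, Real.rpow_one]
    calc x = x ^ ε' * X := e
      _ ≤ x ^ ε' * (Q + 1) := by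
          refine mul_le_mul_of_nonneg_left ?_ (Real.rpow_nonneg hx0.le _)
          linarith
  have hbr2 : x / (D + 1) ≤ x ^ (3 / 4 : ℝ) := by
    rw [div_le_iff₀ (by positivity)]
    have e : x = x ^ (3 / 4 : ℝ) * x ^ (1 / 2 - 1 / 4 : ℝ) := by
      rw [← Real.rpow_add hx0]; norm_num
    calc x = x ^ (3 / 4 : ℝ) * x ^ (1 / 2 - 1 / 4 : ℝ) := e
      _ ≤ x ^ (3 / 4 : ℝ) * (D + 1) :=
          mul_le_mul_of_nonneg_left hDlt.le (Real.rpow_nonneg hx0.le _)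
  have hbr3 : x ^ (1 / 2 : ℝ) * Q ≤ 2 * x ^ (3 / 2 - ε') := by
    have e : x ^ (1 / 2 : ℝ) * X = x ^ (3 / 2 - ε') := by
      rw [hXdef, ← Real.rpow_add hx0]
      have : (1 / 2 : ℝ) + (1 - ε') = 3 / 2 - ε' := by ring
      rw [this]
    calc x ^ (1 / 2 : ℝ) * Q ≤ x ^ (1 / 2 : ℝ) * (2 * X) :=
          mul_le_mul_of_nonneg_left hQle (Real.rpow_nonneg hx0.le _)
      _ = 2 * (x ^ (1 / 2 : ℝ) * X) := by ring
      _ = 2 * x ^ (3 / 2 - ε') := by rw [e]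
  have hbr4 : x ^ (5 / 6 : ℝ) * (1 + Real.log Q) ≤ 3 * (L * x ^ (5 / 6 : ℝ)) := by
    calc x ^ (5 / 6 : ℝ) * (1 + Real.log Q) ≤ x ^ (5 / 6 : ℝ) * (3 * L) :=
          mul_le_mul_of_nonneg_left h1logQ (Real.rpow_nonneg hx0.le _)
      _ = 3 * (L * x ^ (5 / 6 : ℝ)) := by ring
  have h34 : 0 ≤ x ^ (3 / 4 : ℝ) := Real.rpow_nonneg hx0.le _
  have h56 : 0 ≤ x ^ (5 / 6 : ℝ) := Real.rpow_nonneg hx0.le _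
  have hε'0 : 0 ≤ x ^ ε' := Real.rpow_nonneg hx0.le _
  have h32 : 0 ≤ x ^ (3 / 2 - ε') := Real.rpow_nonneg hx0.le _
  set T₄ := x ^ ε' + x ^ (3 / 4 : ℝ) + x ^ (5 / 6 : ℝ) + x ^ (3 / 2 - ε') with hT₄def
  have hT₄0 : 0 ≤ T₄ := by positivity
  have hT₄L : T₄ ≤ L * T₄ := le_mul_of_one_le_left hT₄0 hL1
  have h32L : x ^ (3 / 2 - ε') ≤ L * x ^ (3 / 2 - ε') := le_mul_of_one_le_left h32 hL1
  have hLT : L * x ^ (3 / 2 - ε') + L * x ^ (5 / 6 : ℝ) ≤ L * T₄ := by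
    rw [← mul_add]
    exact mul_le_mul_of_nonneg_left (by rw [hT₄def]; linarith) hL0.le
  have hbr : x / (Q + 1) + x ^ (5 / 6 : ℝ) + x ^ (1 / 2 : ℝ) * Q +
      (x / (D + 1) + x ^ (5 / 6 : ℝ) * (1 + Real.log Q) + x ^ (1 / 2 : ℝ) * Q) ≤ 4 * L * T₄ := by
    have h1 : x / (Q + 1) + x ^ (5 / 6 : ℝ) + x ^ (1 / 2 : ℝ) * Q +
        (x / (D + 1) + x ^ (5 / 6 : ℝ) * (1 + Real.log Q) + x ^ (1 / 2 : ℝ) * Q) ≤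
        T₄ + 3 * x ^ (3 / 2 - ε') + 3 * (L * x ^ (5 / 6 : ℝ)) := by
      rw [hT₄def]; linarith
    have h2 : T₄ + 3 * x ^ (3 / 2 - ε') + 3 * (L * x ^ (5 / 6 : ℝ)) ≤ 4 * L * T₄ := by
      linarith
    exact h1.trans h2
  -- (3) the two parts of the right-hand side
  have hb0 : 0 ≤ x / (Q + 1) + x ^ (5 / 6 : ℝ) + x ^ (1 / 2 : ℝ) * Q +
      (x / (D + 1) + x ^ (5 / 6 : ℝ) * (1 + Real.log Q) + x ^ (1 / 2 : ℝ) * Q) := by positivity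
  have hS1 : totientInvSum Q * (C₁ * Real.log (x * Q) ^ 4 *
      (x / (Q + 1) + x ^ (5 / 6 : ℝ) + x ^ (1 / 2 : ℝ) * Q +
        (x / (D + 1) + x ^ (5 / 6 : ℝ) * (1 + Real.log Q) + x ^ (1 / 2 : ℝ) * Q))) ≤
      2916 * C₁ * L ^ 7 * T₄ := by
    calc totientInvSum Q * (C₁ * Real.log (x * Q) ^ 4 *
          (x / (Q + 1) + x ^ (5 / 6 : ℝ) + x ^ (1 / 2 : ℝ) * Q +
            (x / (D + 1) + x ^ (5 / 6 : ℝ) * (1 + Real.log Q) + x ^ (1 / 2 : ℝ) * Q)))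
        ≤ (9 * L ^ 2) * (C₁ * (81 * L ^ 4) * (4 * L * T₄)) := by
          refine mul_le_mul hWQ ?_ (by positivity) (by positivity)
          exact mul_le_mul (mul_le_mul_of_nonneg_left hlog4 hC₁) hbr hb0 (by positivity)
      _ = 2916 * C₁ * L ^ 7 * T₄ := by ring
  have hS2 : (⌊L / Real.log 2⌋₊ : ℝ) * ((Q : ℝ) * Real.log Q * totientInvSum Q) ≤
      72 * L ^ 4 * X := by
    have hQW : (Q : ℝ) * Real.log Q * totientInvSum Q ≤ 2 * X * (2 * L) * (9 * L ^ 2) :=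
      mul_le_mul (mul_le_mul hQle hlogQ hlogQ0 (by positivity)) hWQ (totientInvSum_nonneg Q)
        (by positivity)
    have hQW0 : 0 ≤ (Q : ℝ) * Real.log Q * totientInvSum Q :=
      mul_nonneg (mul_nonneg (Nat.cast_nonneg _) hlogQ0) (totientInvSum_nonneg Q)
    calc (⌊L / Real.log 2⌋₊ : ℝ) * ((Q : ℝ) * Real.log Q * totientInvSum Q)
        ≤ 2 * L * (2 * X * (2 * L) * (9 * L ^ 2)) := mul_le_mul hfl hQW hQW0 (by positivity)
      _ = 72 * L ^ 4 * X := by ring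
  exact hS.trans (add_le_add hS1 hS2)

/-- **The five terms against the target.** With `η ≤ (1−ε')/2`, `η ≤ (ε'−1/2)/2`, `η ≤ 1/24`,
`L = log x ≥ 1` and the key condition `(29160 C₁ + 720)(L^B L^7) ≤ x^η`:
`2916 C₁ L^7 (x^{ε'} + x^{3/4} + x^{5/6} + x^{3/2−ε'}) + 72 L^4 x^{1−ε'} ≤ x^{1−η}/(2 L^B)`.
[folklore] -/
theorem fiveTerms_le {x ε' C₁ B η : ℝ} (hx1 : 1 ≤ x) (hL1 : 1 ≤ Real.log x) (hC₁ : 0 ≤ C₁)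
    (hη1 : η ≤ (1 - ε') / 2) (hη2 : η ≤ (ε' - 1 / 2) / 2) (hη3 : η ≤ 1 / 24)
    (hE : (29160 * C₁ + 720) * (Real.log x ^ B * Real.log x ^ 7) ≤ x ^ η) :
    2916 * C₁ * Real.log x ^ 7 *
          (x ^ ε' + x ^ (3 / 4 : ℝ) + x ^ (5 / 6 : ℝ) + x ^ (3 / 2 - ε')) +
        72 * Real.log x ^ 4 * x ^ (1 - ε') ≤
      x ^ (1 - η) / (2 * Real.log x ^ B) := by
  set L := Real.log x with hLdef
  have hL0 : 0 < L := by linarith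
  have hLB : 0 < L ^ B := Real.rpow_pos_of_pos hL0 B
  have hE1 : 29160 * C₁ * (L ^ B * L ^ 7) ≤ x ^ η := by
    refine le_trans (mul_le_mul_of_nonneg_right ?_ (by positivity)) hE
    linarith
  have hE2 : 720 * (L ^ B * L ^ 4) ≤ x ^ η := by
    have hL47 : L ^ 4 ≤ L ^ 7 := pow_le_pow_right₀ hL1 (by norm_num)
    calc 720 * (L ^ B * L ^ 4) ≤ 720 * (L ^ B * L ^ 7) := by gcongr
      _ ≤ (29160 * C₁ + 720) * (L ^ B * L ^ 7) := by
          refine mul_le_mul_of_nonneg_right ?_ (by positivity)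
          nlinarith
      _ ≤ x ^ η := hE
  have hP1 : 29160 * C₁ * (L ^ B * L ^ 7) * x ^ ε' ≤ x ^ (1 - η) :=
    term_le hx1 hE1 (by linarith)
  have hP2 : 29160 * C₁ * (L ^ B * L ^ 7) * x ^ (3 / 4 : ℝ) ≤ x ^ (1 - η) :=
    term_le hx1 hE1 (by linarith)
  have hP3 : 29160 * C₁ * (L ^ B * L ^ 7) * x ^ (5 / 6 : ℝ) ≤ x ^ (1 - η) :=
    term_le hx1 hE1 (by linarith)
  have hP4 : 29160 * C₁ * (L ^ B * L ^ 7) * x ^ (3 / 2 - ε') ≤ x ^ (1 - η) :=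
    term_le hx1 hE1 (by linarith)
  have hP5 : 720 * (L ^ B * L ^ 4) * x ^ (1 - ε') ≤ x ^ (1 - η) :=
    term_le hx1 hE2 (by linarith)
  have hmain : 10 * L ^ B * (2916 * C₁ * L ^ 7 *
        (x ^ ε' + x ^ (3 / 4 : ℝ) + x ^ (5 / 6 : ℝ) + x ^ (3 / 2 - ε')) +
      72 * L ^ 4 * x ^ (1 - ε')) ≤ 5 * x ^ (1 - η) := by
    calc 10 * L ^ B * (2916 * C₁ * L ^ 7 *
            (x ^ ε' + x ^ (3 / 4 : ℝ) + x ^ (5 / 6 : ℝ) + x ^ (3 / 2 - ε')) +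
          72 * L ^ 4 * x ^ (1 - ε'))
        = 29160 * C₁ * (L ^ B * L ^ 7) * x ^ ε' +
            29160 * C₁ * (L ^ B * L ^ 7) * x ^ (3 / 4 : ℝ) +
            29160 * C₁ * (L ^ B * L ^ 7) * x ^ (5 / 6 : ℝ) +
            29160 * C₁ * (L ^ B * L ^ 7) * x ^ (3 / 2 - ε') +
            720 * (L ^ B * L ^ 4) * x ^ (1 - ε') := by ring
      _ ≤ x ^ (1 - η) + x ^ (1 - η) + x ^ (1 - η) + x ^ (1 - η) + x ^ (1 - η) := by
          linarith [hP1, hP2, hP3, hP4, hP5]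
      _ = 5 * x ^ (1 - η) := by ring
  rw [le_div_iff₀ (by positivity)]
  linarith [hmain]

/-- **Power-sparse purity of the excised discrepancy in every window below `x^{1/2}`**
(unconditional; the `k = 1`, Bombieri–Vinogradov-strength rung of the line).  For a window
exponent `ε' ∈ (1/2, 1)` and every `B > 0`: with the conductor cut `δ₀ = 1/4` and
`η = min(min((1−ε')/2, (ε'−1/2)/2), 1/24)`, for `x ≥ x₀` all but at most `x^{1−ε'−η}` moduli
`m ∈ (x^{1−ε'}, 2x^{1−ε'}]` satisfy
`max_{a} ‖φ(m)⁻¹ ∑_{χ mod m, cond χ > ⌊x^{1/4}⌋} χ(a⁻¹) ψ(x, χ)‖ < x/(φ(m)(log x)^B)`.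
Proof: Markov on the first moment `∑_{q ≤ 2x^{1−ε'}} E♯(x; q) ≤ x^{1−η}/(2(log x)^B)`
(`HighConductorReduction.exists_sum_excised_le`, `firstMoment_le`, `fiveTerms_le`): the three
ranges of conductors contribute `x^{3/4}` (from `x/D`), `x^{5/6}` and `x^{1/2} · x^{1−ε'}`, all
`≤ x^{1−2η}` up to powers of `log x` exactly when `ε' > 1/2`.  This is the hypothesis `hPurity`
of the landed graded bridge `OfTopWindowPurity.eh_level_of_purityAt` at exponent `ε'`.
[cite: Vaughan1980, Theorem 1] [cite: DavenportMNT1980, ch. 28] -/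
theorem purityAt_of_gt_half (ε' : ℝ) (hε' : 1 / 2 < ε') (hε'1 : ε' < 1) :
    ∀ B : ℝ, 0 < B →
      ∃ δ₀ : ℝ, 0 < δ₀ ∧ δ₀ < 1 / 2 ∧ ∃ η : ℝ, 0 < η ∧ ∃ x₀ : ℝ, ∀ x : ℝ, x₀ ≤ x →
        ∃ I : Finset ℕ, (I.card : ℝ) ≤ x ^ (1 - ε' - η) ∧
          ∀ m ∈ Finset.Ioc ⌊x ^ (1 - ε')⌋₊ ⌊2 * x ^ (1 - ε')⌋₊, m ∉ I →
            (⨆ a : (ZMod m)ˣ,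
                ‖((Nat.totient m : ℂ))⁻¹ *
                    ∑ χ ∈ (Finset.univ : Finset (DirichletCharacter ℂ m)) with
                        ⌊x ^ (1 / 2 - δ₀)⌋₊ < χ.conductor,
                      χ (a : ZMod m)⁻¹ * Literature.NumberTheory.Sieve.chebyshevPsiChar χ x‖) <
              x / ((Nat.totient m : ℝ) * Real.log x ^ B) := by
  classical
  intro B _hB
  obtain ⟨C₁, hC₁, hV⟩ := HighConductorReduction.exists_sum_excised_le
  set η : ℝ := min (min ((1 - ε') / 2) ((ε' - 1 / 2) / 2)) (1 / 24) with hηdef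
  have hη0 : 0 < η := lt_min (lt_min (by linarith) (by linarith)) (by norm_num)
  have hη1 : η ≤ (1 - ε') / 2 := (min_le_left _ _).trans (min_le_left _ _)
  have hη2 : η ≤ (ε' - 1 / 2) / 2 := (min_le_left _ _).trans (min_le_right _ _)
  have hη3 : η ≤ 1 / 24 := min_le_right _ _
  set K₀ : ℝ := 29160 * C₁ + 720 with hK₀def
  have hK₀1 : (1 : ℝ) ≤ K₀ := by rw [hK₀def]; nlinarith
  obtain ⟨x₀, hx₀⟩ := Filter.eventually_atTop.1 (eventually_conds K₀ B hη0)
  refine ⟨1 / 4, by norm_num, by norm_num, η, hη0, x₀, fun x hx => ?_⟩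
  obtain ⟨hx2, hK₀L, hLη⟩ := hx₀ x hx
  -- notation
  set L := Real.log x with hLdef
  set X := x ^ (1 - ε') with hXdef
  set D := ⌊x ^ (1 / 2 - 1 / 4 : ℝ)⌋₊ with hDdef
  set Q := ⌊2 * X⌋₊ with hQdef
  set W := Finset.Ioc ⌊X⌋₊ Q with hWdef
  set Es : ℕ → ℝ := fun m => ⨆ a : (ZMod m)ˣ,
      ‖((Nat.totient m : ℂ))⁻¹ *
          ∑ χ ∈ (Finset.univ : Finset (DirichletCharacter ℂ m)) with D < χ.conductor,
            χ (a : ZMod m)⁻¹ * chebyshevPsiChar χ x‖ with hEsdef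
  have hx0 : 0 < x := by linarith
  have hx1 : 1 ≤ x := by linarith
  have hL1 : 1 ≤ L := hK₀1.trans hK₀L
  have hL0 : 0 < L := by linarith
  have hX1 : 1 ≤ X := Real.one_le_rpow hx1 (by linarith)
  have hX0 : 0 < X := by linarith
  have hLB : 0 < L ^ B := Real.rpow_pos_of_pos hL0 B
  have hQ1 : 1 ≤ Q := Nat.le_floor (by rw [Nat.cast_one]; linarith)
  have hQle : (Q : ℝ) ≤ 2 * X := Nat.floor_le (by positivity)
  have hx14 : (1 : ℝ) ≤ x ^ (1 / 2 - 1 / 4 : ℝ) := Real.one_le_rpow hx1 (by norm_num)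
  have hD1 : 1 ≤ D := Nat.le_floor (by rw [Nat.cast_one]; exact hx14)
  -- the exceptional set: the impure moduli of the window
  set I := W.filter (fun m => x / ((Nat.totient m : ℝ) * L ^ B) ≤ Es m) with hIdef
  refine ⟨I, ?_, fun m hm hmI => ?_⟩
  swap
  · have : ¬ (x / ((Nat.totient m : ℝ) * L ^ B) ≤ Es m) := fun h =>
      hmI (Finset.mem_filter.2 ⟨hm, h⟩)
    exact lt_of_not_ge this
  -- (1) the first moment over `q ≤ Q`
  set S := ∑ q ∈ Finset.Icc 1 Q, Es q with hSdef
  have hS : S ≤ _ := hV x hx2 Q D hQ1 hD1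
  have hL8 : L ^ (B + 8) = L ^ B * L ^ 7 * L := by
    have hL7 : L ^ (7 : ℝ) = L ^ 7 := by
      rw [show (7 : ℝ) = (7 : ℕ) by norm_num, Real.rpow_natCast]
    rw [show B + 8 = B + 7 + 1 by ring, Real.rpow_add hL0, Real.rpow_one, Real.rpow_add hL0, hL7]
  have hE : K₀ * (L ^ B * L ^ 7) ≤ x ^ η := by
    calc K₀ * (L ^ B * L ^ 7) ≤ L * (L ^ B * L ^ 7) :=
          mul_le_mul_of_nonneg_right hK₀L (by positivity)
      _ = L ^ (B + 8) := by rw [hL8]; ring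
      _ ≤ x ^ η := hLη
  have hSfin : S ≤ x ^ (1 - η) / (2 * L ^ B) :=
    (firstMoment_le hx2 hL1 (by linarith) hε'1 hC₁ hS).trans (fiveTerms_le hx1 hL1 hC₁ hη1 hη2 hη3 hE)
  -- (2) Markov
  have hWsub : W ⊆ Finset.Icc 1 Q := by
    intro m hm
    rw [hWdef, Finset.mem_Ioc] at hm
    exact Finset.mem_Icc.2 ⟨by omega, hm.2⟩
  have hsumI : ∑ m ∈ I, Es m ≤ S :=
    Finset.sum_le_sum_of_subset_of_nonneg ((Finset.filter_subset _ _).trans hWsub)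
      fun m _ _ => Real.iSup_nonneg fun a => norm_nonneg _
  have hthr : ∀ m ∈ I, x / (2 * X * L ^ B) ≤ Es m := by
    intro m hm
    obtain ⟨hmW, hmE⟩ := Finset.mem_filter.1 hm
    rw [hWdef, Finset.mem_Ioc] at hmW
    have hm1 : 1 ≤ m := by omega
    have hφ : (Nat.totient m : ℝ) ≤ 2 * X :=
      calc (Nat.totient m : ℝ) ≤ m := by exact_mod_cast Nat.totient_le m
        _ ≤ Q := by exact_mod_cast hmW.2
        _ ≤ 2 * X := hQle
    have hφ0 : (0 : ℝ) < Nat.totient m := by exact_mod_cast Nat.totient_pos.2 hm1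
    refine le_trans ?_ hmE
    exact div_le_div_of_nonneg_left hx0.le (by positivity)
      (mul_le_mul_of_nonneg_right hφ hLB.le)
  have ht : 0 < x / (2 * X * L ^ B) := by positivity
  have hcard := PurityLogOfEH.card_le_div_of_le_sum ht hthr (hsumI.trans hSfin)
  calc (I.card : ℝ) ≤ x ^ (1 - η) / (2 * L ^ B) / (x / (2 * X * L ^ B)) := hcard
    _ = x ^ (1 - η) * X / x := by field_simp
    _ = x ^ (1 - ε' - η) := by
        rw [div_eq_iff hx0.ne', hXdef, ← Real.rpow_add hx0]
        nth_rw 3 [← Real.rpow_one x]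
        rw [← Real.rpow_add hx0]
        congr 1
        ring

/-- **The Bombieri–Vinogradov range of the line** (`EH θ`, Wave0 form, for every `θ < 1/2`),
re-derived THROUGH the line: purity below `x^{1/2}` (`purityAt_of_gt_half` at
`ε' = (3/2 − max(θ,0))/2 ∈ (1/2, 3/4]`) fed into the landed graded bridge
`OfTopWindowPurity.eh_level_of_purityAt` (low conductors + replication + bad-moduli sparsity +
graded descent).  Not a new theorem about primes (`Literature.NumberTheory.Sieve.eh_of_bombieri_vinogradov`),
but the kernel certificate that the line closes exactly down to the large-sieve barrier
`Literature.Barriers.Parity.LargeSieveLevelHalf`: its purity stub holds in every window below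
`x^{1/2}` and is equivalent to a new level of distribution in every window above it
(`eh_level_of_purityAt`, `Localisation.eh_below_iff_purityLog_below`). [folklore] -/
theorem eh_of_lt_half (θ : ℝ) (hθ : θ < 1 / 2) : Literature.NumberTheory.Sieve.EH θ := by
  have h0 : 0 ≤ max θ 0 := le_max_right _ _
  have h1 : θ ≤ max θ 0 := le_max_left _ _
  have h2 : max θ 0 < 1 / 2 := max_lt hθ (by norm_num)
  exact OfTopWindowPurity.eh_level_of_purityAt ((3 / 2 - max θ 0) / 2) (by linarith)
    (purityAt_of_gt_half ((3 / 2 - max θ 0) / 2) (by linarith) (by linarith)) θ (by linarith)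

end Summit.Parity.GeneralizedHardyLittlewood.Theorems.EH.PurityBelowHalf
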